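import Mathlib
import Summits.Ventures.PercRepro2.SixTypedOrbit
import Summits.Ventures.PercRepro2.TypedTripleRows

/-!
# Eight typed edges, 0: the offset row-table sum of an orbit list (blind cell PercRepro2, night-3 g10, 2026-08-26)

`olkT` = `olk` with the row lookup `lkT` in place of `lk2''`, and `olkT_eq` (= `olk_eq`).
-/

namespace Summit.Ventures.PercRepro2

open UnionCluster

namespace CovForm

namespace TwoTyped

open OneTyped

section OlkT

/-- The offset ROW-table sum of an orbit list on state indices (`lkT` in place of `lk2''`). -/
def olkT (s : ℕ → ℕ) (l : List (ℕ × ℕ × ℕ × ℕ)) : ℕ :=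
  (l.map fun o => if o.1 = 1 then lk1 (s o.2.1) (s o.2.2.1) else lkT (s o.2.1) (s o.2.2.1) (s o.2.2.2)).sum

/-- **The row-table sum on state indices is the orbit sum, offset** (`lk1_eq`, `lkT_eq`). -/
lemma olkT_eq (S : ℕ → St) (hv : ∀ m, valid (S m) = true) (l : List (ℕ × ℕ × ℕ × ℕ)) :
    (2 * olkT (fun m => idx (S m)) l : ℤ) = osum S l + 2 * need l := by
  induction l with
  | nil => rfl
  | cons o l ih =>
    simp only [olkT, need, osum, List.map_cons, List.sum_cons] at ih ⊢
    push_cast at ih ⊢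
    split_ifs with h1
    · have := lk1_eq (S o.2.1) (S o.2.2.1) (hv _) (hv _)
      linarith
    · have := lkT_eq (S o.2.1) (S o.2.2.1) (S o.2.2.2) (hv _) (hv _) (hv _)
      linarith

end OlkT

end TwoTyped

end CovForm

end Summit.Ventures.PercRepro2
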